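import Summits.NavierStokesRegularity.FunctionalMining.VelocityL4Production
import Summits.NavierStokesRegularity.FunctionalMining.VelocityL6Interpolation
import HarnessLib

/-!
# FunctionalMining — the pressure production of `U₆ = ∫|u|⁶`:
# `∫ p |u|² ∑ₖuₖ∂ₖ|u|² = −½ ∫|u|⁴⟪∇p, u⟫` and its bound by `√(∫|u|¹⁰) √(∫|∇p|²)`

search for candidate a priori estimates; no regularity claim. Cell `pub-nsfunc`, prove seat
(gen 8). Static identities/inequalities for a smooth divergence-free field `u` and a smooth scalar
`p` on `T^d` (inputs of the `L⁶` velocity-moment law, K0 row `EV.s=6|T_LD|G1`, companion file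
`VelocityL6SaturatingLaw`).

* `pressure_term6_eq` — `∫ p ‖u‖² ∑ₖ uₖ ∂ₖ‖u‖² = −½ ∫ ‖u‖⁴ ⟪∇p, u⟫` for divergence-free `u`
  (integration by parts per `k`; `∑ₖ∂ₖ(p‖u‖²uₖ) = ⟪∇p,u⟩‖u‖² + p∑ₖuₖ∂ₖ‖u‖² + p‖u‖² div u`).
* `abs_pressure_term6_le` — `|∫ ‖u‖⁴⟪∇p, u⟫| ≤ √(∫‖u‖¹⁰) √(∫‖∇p‖²)` (Cauchy–Schwarz).
[ours; elementary]
-/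

noncomputable section

open MeasureTheory Finset
open scoped InnerProductSpace RealInnerProductSpace ContDiff

namespace Summit.NavierStokesRegularity.FunctionalMining

open Literature.Analysis.FunctionSpaces Literature.Analysis.FunctionSpaces.Torus

namespace VelocityL6

variable {d : Type*} [Fintype d] [DecidableEq d]

/-- **The pressure production of `∫|u|⁶`, integrated by parts**: for smooth divergence-free `u` and
smooth `p` on `T^d`, `∫ p ‖u‖² ∑ₖ uₖ ∂ₖ(‖u‖²) = −½ ∫ ‖u‖⁴ ⟪∇p, u⟫`.
[cite: RobinsonRodrigoSadowski2016, Ch. 11 Exercise 11.4] -/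
theorem pressure_term6_eq {u : UnitAddTorus d → EuclideanSpace ℝ d} (hu : IsSmooth u)
    (hdiv : IsDivFree u) {p : UnitAddTorus d → ℝ} (hp : IsSmooth p) :
    ∫ x, p x * (‖u x‖ ^ 2 * ∑ k, u x k * partialDeriv k (fun y => ‖u y‖ ^ 2) x) =
      -(1 / 2) * ∫ x, ‖u x‖ ^ 4 * ⟪gradient p x, u x⟫ := by
  set g : UnitAddTorus d → ℝ := fun y => ‖u y‖ ^ 2 with hg
  have hgs : IsSmooth g := hu.norm_sq
  have huk : ∀ k, IsSmooth (fun y => u y k) := fun k => hu.apply k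
  have hpg : IsSmooth (fun y => p y * g y) := hp.mul hgs
  have hpgk : ∀ k, IsSmooth (fun y => p y * g y * u y k) := fun k => hpg.mul (huk k)
  -- per-coordinate integration by parts: `∫ p g uₖ ∂ₖg = −∫ g ∂ₖ(p g uₖ)`
  have hk : ∀ k, ∫ x, p x * (g x * (u x k * partialDeriv k g x)) =
      -∫ x, g x * (partialDeriv k p x * g x * u x k + p x * partialDeriv k g x * u x k +
        p x * g x * partialDeriv k (fun y => u y k) x) := by
    intro k
    have h1 : ∫ x, p x * (g x * (u x k * partialDeriv k g x)) =
        ∫ x, partialDeriv k g x * (p x * g x * u x k) :=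
      integral_congr_ae (ae_of_all _ fun x => by ring)
    rw [h1, Literature.Analysis.FluidPDE.Torus.integral_partialDeriv_mul_eq_neg_integral hgs (hpgk k) k]
    congr 1
    refine integral_congr_ae (ae_of_all _ fun x => ?_)
    dsimp only
    rw [partialDeriv_mul (hpg.isContDiff (by simp)) ((huk k).isContDiff (by simp)) k x,
      partialDeriv_mul (hp.isContDiff (by simp)) (hgs.isContDiff (by simp)) k x]
    ring
  have hint : ∀ k, Integrable (fun x => p x * (g x * (u x k * partialDeriv k g x))) volume :=
    fun k => (hp.continuous.mul (hgs.continuous.mul ((huk k).continuous.mul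
      (hgs.partialDeriv k).continuous))).integrable_unitAddTorus
  have hL : ∫ x, p x * (‖u x‖ ^ 2 * ∑ k, u x k * partialDeriv k g x) =
      ∑ k, ∫ x, p x * (g x * (u x k * partialDeriv k g x)) := by
    rw [← integral_finsetSum _ fun k _ => hint k]
    exact integral_congr_ae (ae_of_all _ fun x => by simp only [hg, Finset.mul_sum])
  have hint2 : ∀ k, Integrable (fun x => g x * (partialDeriv k p x * g x * u x k +
      p x * partialDeriv k g x * u x k + p x * g x * partialDeriv k (fun y => u y k) x)) volume :=
    fun k => (hgs.continuous.mul ((((hp.partialDeriv k).continuous.mul hgs.continuous).mul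
      (huk k).continuous).add ((hp.continuous.mul (hgs.partialDeriv k).continuous).mul
      (huk k).continuous) |>.add ((hp.continuous.mul hgs.continuous).mul
      ((huk k).partialDeriv k).continuous))).integrable_unitAddTorus
  -- pointwise: the sum equals `g²⟪∇p,u⟫ + p g ∑ₖuₖ∂ₖg` (`div u = 0`)
  have hptw : ∀ x, ∑ k, g x * (partialDeriv k p x * g x * u x k +
      p x * partialDeriv k g x * u x k + p x * g x * partialDeriv k (fun y => u y k) x) =
      g x ^ 2 * ⟪gradient p x, u x⟫ + p x * (g x * ∑ k, u x k * partialDeriv k g x) := by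
    intro x
    have hdx : ∑ k, partialDeriv k (fun y => u y k) x = 0 := hdiv x
    have hgrad := VelocityL4.sum_partialDeriv_mul_eq_inner_gradient hp x (u x)
    calc ∑ k, g x * (partialDeriv k p x * g x * u x k + p x * partialDeriv k g x * u x k +
          p x * g x * partialDeriv k (fun y => u y k) x)
        = g x ^ 2 * ∑ k, partialDeriv k p x * u x k +
            p x * (g x * ∑ k, u x k * partialDeriv k g x) +
            p x * g x ^ 2 * ∑ k, partialDeriv k (fun y => u y k) x := by
          rw [Finset.mul_sum, Finset.mul_sum, Finset.mul_sum, Finset.mul_sum, ← Finset.sum_add_distrib,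
            ← Finset.sum_add_distrib]
          exact Finset.sum_congr rfl fun k _ => by ring
      _ = g x ^ 2 * ⟪gradient p x, u x⟫ + p x * (g x * ∑ k, u x k * partialDeriv k g x) := by
          rw [hdx, hgrad]; ring
  have hi1 : Integrable (fun x => g x ^ 2 * ⟪gradient p x, u x⟫) volume :=
    ((hgs.continuous.pow 2).mul ((hp.gradient.continuous.inner hu.continuous))).integrable_unitAddTorus
  have hcs : Continuous fun x => ∑ k, u x k * partialDeriv k g x :=
    continuous_finsetSum _ fun k _ => (huk k).continuous.mul (hgs.partialDeriv k).continuous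
  have hi2 : Integrable (fun x => p x * (g x * ∑ k, u x k * partialDeriv k g x)) volume :=
    (hp.continuous.mul (hgs.continuous.mul hcs)).integrable_unitAddTorus
  have hA : ∫ x, g x ^ 2 * ⟪gradient p x, u x⟫ = ∫ x, ‖u x‖ ^ 4 * ⟪gradient p x, u x⟫ :=
    integral_congr_ae (ae_of_all _ fun x => by simp only [hg]; ring)
  -- the self-referential identity `X = −(A + X)`
  have key : ∫ x, p x * (g x * ∑ k, u x k * partialDeriv k g x) =
      -((∫ x, ‖u x‖ ^ 4 * ⟪gradient p x, u x⟫) +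
        ∫ x, p x * (g x * ∑ k, u x k * partialDeriv k g x)) := by
    calc ∫ x, p x * (g x * ∑ k, u x k * partialDeriv k g x)
        = ∑ k, ∫ x, p x * (g x * (u x k * partialDeriv k g x)) := hL
      _ = ∑ k, -∫ x, g x * (partialDeriv k p x * g x * u x k + p x * partialDeriv k g x * u x k +
            p x * g x * partialDeriv k (fun y => u y k) x) := Finset.sum_congr rfl fun k _ => hk k
      _ = -∫ x, ∑ k, g x * (partialDeriv k p x * g x * u x k + p x * partialDeriv k g x * u x k +
            p x * g x * partialDeriv k (fun y => u y k) x) := by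
          rw [Finset.sum_neg_distrib, ← integral_finsetSum _ fun k _ => hint2 k]
      _ = -((∫ x, ‖u x‖ ^ 4 * ⟪gradient p x, u x⟫) +
            ∫ x, p x * (g x * ∑ k, u x k * partialDeriv k g x)) := by
          rw [integral_congr_ae (ae_of_all _ hptw), integral_add hi1 hi2, hA]
  have hgoal : ∫ x, p x * (‖u x‖ ^ 2 * ∑ k, u x k * partialDeriv k g x) =
      ∫ x, p x * (g x * ∑ k, u x k * partialDeriv k g x) := rfl
  rw [hgoal]
  linarith

omit [DecidableEq d] in
/-- **Cauchy–Schwarz for the `L⁶` pressure production**: `|∫ ‖u‖⁴⟪∇p, u⟫| ≤ √(∫‖u‖¹⁰) √(∫‖∇p‖²)`.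
[folklore] -/
theorem abs_pressure_term6_le {u : UnitAddTorus d → EuclideanSpace ℝ d} (hu : IsSmooth u)
    {p : UnitAddTorus d → ℝ} (hp : IsSmooth p) :
    |∫ x, ‖u x‖ ^ 4 * ⟪gradient p x, u x⟫| ≤
      Real.sqrt (∫ x, ‖u x‖ ^ 10) * Real.sqrt (∫ x, ‖gradient p x‖ ^ 2) := by
  have hcu : Continuous u := hu.continuous
  have hcg : Continuous (gradient p) := hp.gradient.continuous
  have hc5 : Continuous fun x => ‖u x‖ ^ 5 := hcu.norm.pow 5
  have hcn : Continuous fun x => ‖gradient p x‖ := hcg.norm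
  have h1 : |∫ x, ‖u x‖ ^ 4 * ⟪gradient p x, u x⟫| ≤ ∫ x, ‖u x‖ ^ 5 * ‖gradient p x‖ := by
    have hi : Integrable (fun x => ‖u x‖ ^ 5 * ‖gradient p x‖) volume :=
      (hc5.mul hcn).integrable_unitAddTorus
    calc |∫ x, ‖u x‖ ^ 4 * ⟪gradient p x, u x⟫| ≤ ∫ x, |‖u x‖ ^ 4 * ⟪gradient p x, u x⟫| :=
          abs_integral_le_integral_abs
      _ ≤ ∫ x, ‖u x‖ ^ 5 * ‖gradient p x‖ := by
          refine integral_mono_of_nonneg (ae_of_all _ fun x => abs_nonneg _) hi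
            (ae_of_all _ fun x => ?_)
          dsimp only
          rw [abs_mul, abs_of_nonneg (by positivity)]
          have hcs := abs_real_inner_le_norm (gradient p x) (u x)
          calc ‖u x‖ ^ 4 * |⟪gradient p x, u x⟫| ≤ ‖u x‖ ^ 4 * (‖gradient p x‖ * ‖u x‖) :=
                mul_le_mul_of_nonneg_left hcs (by positivity)
            _ = ‖u x‖ ^ 5 * ‖gradient p x‖ := by ring
  have h2 := integral_mul_le_sqrt_mul_sqrt hc5 hcn
  have e : ∫ x, (‖u x‖ ^ 5) ^ 2 = ∫ x, ‖u x‖ ^ 10 :=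
    integral_congr_ae (ae_of_all _ fun x => by ring)
  rw [e] at h2
  exact h1.trans h2

end VelocityL6

end Summit.NavierStokesRegularity.FunctionalMining
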